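import Summits.CriticalPhenomena.PercolationContinuityZ3.Theorems.PercNearOneGluingNoHeavyPcintBSMRSiteAssembly
import Summits.CriticalPhenomena.PercolationContinuityZ3.Theorems.PercNearOneGluingNoHeavyPcintBSMRKernel
import Summits.CriticalPhenomena.PercolationContinuityZ3.Theorems.PercNearOneGluingNoHeavyPcintBSMRSym2
import Summits.CriticalPhenomena.PercolationContinuityZ3.Theorems.PercNearOneGluingNoHeavyPcintBSMXSiteKernel
import Summits.CriticalPhenomena.PercolationContinuityZ3.Theorems.PercNearOneGluingNoHeavyPcintBSMXSiteSym
import HarnessLib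

/-!
# PCINT lane, PHASE 9 (block renewal with reach-`m` pieces), SITE version: the site kernel theorem

Cell `prim-pcint`, seat `prim-pcint-1` (gen 17); memo `run/shared/lean/prim/pcint/T-FIBRE-ROUTE.md` §PHASE 9.

**`BSMR.siteCriticalProb_le_of_checks`**, the reach-`m` analogue of `BSMX.siteCriticalProb_le_of_checks5V`:
decidable hypotheses (reach-`m` cube, vertex cube, natural marginal identity `BSMR.MargN`, real-form Green tables
on canonical offsets covering `[-6m,6m]^t`, potential tables on `[-4m,4m]^t`, the integer site functional
`BSMX.certLHSVz` on `[-2m,2m]^t` with any shared-vertex count agreeing with `BSMX.SV` there) plus a tail bound give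
`p_c^site(ℤ^{k+t}) ≤ P/10^4`; and the dihedral orbit reduction of the integer site certificate for general radii
(**`BSMR.certZV_of_reps`**, port of `BSMX.certZV_of_reps2`).
-/

noncomputable section

namespace Summit.CriticalPhenomena.PercolationContinuityZ3.Theorems.Pcint.BSMR

open Finset OSM BSM BSMX Literature.Probability.Percolation Literature.Probability.LatticeModels

variable {m t k np : ℕ}

/-- **`p_c^site(ℤ^{k+t}) ≤ P/10^4` from decidable checks** (integer site certificate, reach `m`). -/
theorem siteCriticalProb_le_of_checks (hk : 2 ≤ k) (pc : Fin np → List (Fin t × Bool))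
    (pe : Fin np → (Fin t → ℤ)) (hpe : ∀ σ, pe σ = pend (pc σ)) (E : ℕ) (hE : ∀ σ, (pc σ).length + 1 ≤ E)
    (St : (Fin t → ℤ) → Fin np → Fin np → ℕ) (hSt : ∀ y ∈ boxList t (2 * m), ∀ σ σ', St y σ σ' = SV pc k y σ σ')
    (W : Fin np → ℕ) (DW : ℕ) (hDW : 0 < DW)
    {A : List ℕ} {DA : ℕ} (hA : LawNatOK m A DA)
    (hcube : Cube m pc) (hvc : VertCube m pc k) (hmarg : MargN m pc W DW A DA) {P : ℕ} (hP0 : 0 < P)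
    (hP1 : P ≤ 10000) {N : ℕ} (DG DΦ Tn : ℕ) (hDG : 0 < DG) (hDΦ : 0 < DΦ)
    (hT : TailBoundH t k m (lawN m A DA) N ((Tn : ℝ) / DG))
    (G0n G1n V0n V1n Φn : (Fin t → ℤ) → ℕ) (CL : List (Fin t → ℤ)) (hCL : ∀ δ ∈ boxList t (6 * m), canonK δ ∈ CL)
    (hG0 : ∀ δ ∈ CL, G0H k m (lawN m A DA) N δ * DG ≤ G0n δ)
    (hG1 : ∀ δ ∈ CL, G1H k m (lawN m A DA) N δ * DG ≤ G1n δ)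
    (hV0 : ∀ u ∈ boxList t (4 * m),
      1 + ((boxList t (2 * m)).map fun z => (G0n (canonK (z - u)) + Tn) * Φn z).sum ≤ V0n u)
    (hV1 : ∀ u ∈ boxList t (4 * m),
      1 + ((boxList t (2 * m)).map fun z => (G1n (canonK (z - u)) + Tn) * Φn z).sum ≤ V1n u)
    (hcert : ∀ y ∈ boxList t (2 * m), certLHSVz pe St W k 10000 P E V0n V1n y * DΦ ≤
      (Φn y : ℤ) * ((P ^ E * k * DW ^ 2 * (DG * DΦ) : ℕ) : ℤ)) :
    siteCriticalProb (zdGraph (k + t)) (0 : Site (k + t)) ≤ (P : ℝ) / 10000 := by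
  have hPR : (0 : ℝ) < P := by exact_mod_cast hP0
  have hDGR : (0 : ℝ) < DG := by exact_mod_cast hDG
  have hDΦR : (0 : ℝ) < DΦ := by exact_mod_cast hDΦ
  have hDWR : (0 : ℝ) < DW := by exact_mod_cast hDW
  have hg := lawOK_of_nat hA
  set g := lawN m A DA with hgdef
  have hp0 : (0 : ℝ) < (P : ℝ) / 10000 := by positivity
  have hp1 : (P : ℝ) / 10000 ≤ 1 := by rw [div_le_one (by norm_num)]; exact_mod_cast hP1
  set w : Fin np → ℝ := fun σ => (W σ : ℝ) / DW with hw
  have hmarg' : Marg m pc w g := marg_of_margN hDW hA.1 hmarg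
  have hw0 : ∀ σ, 0 ≤ w σ := fun σ => by rw [hw]; positivity
  have hzu : ∀ z ∈ boxList t (2 * m), ∀ u ∈ boxList t (4 * m), z - u ∈ boxList t (6 * m) := by
    intro z hz u hu
    rw [mem_boxList] at hz hu ⊢
    intro i
    have h1 := hz i; have h2 := hu i
    simp only [Pi.sub_apply]
    push_cast at h1 h2 ⊢
    constructor <;> omega
  have hYb : ∀ z, z ∈ Box t (2 * m) → z ∈ boxList t (2 * m) := fun z hz => by
    rwa [Box_eq_toFinset t (2 * m), List.mem_toFinset] at hz
  set φ : (Fin t → ℤ) → ℝ := fun y => if y ∈ boxList t (2 * m) then (Φn y : ℝ) / DΦ else 0 with hφdef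
  have hφ0 : ∀ y, 0 ≤ φ y := fun y => by
    rw [hφdef]; dsimp only; split_ifs
    · positivity
    · exact le_rfl
  have hφin : ∀ y ∈ boxList t (2 * m), φ y = (Φn y : ℝ) / DΦ := fun y hy => by
    rw [hφdef]; dsimp only; rw [if_pos hy]
  set V0f : (Fin t → ℤ) → ℝ := fun u => (V0n u : ℝ) / ((DG * DΦ : ℕ) : ℝ) with hV0f
  set V1f : (Fin t → ℤ) → ℝ := fun u => (V1n u : ℝ) / ((DG * DΦ : ℕ) : ℝ) with hV1f
  have hG0' : ∀ z ∈ boxList t (2 * m), ∀ u ∈ boxList t (4 * m),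
      G0H k m g N (z - u) + (Tn : ℝ) / DG ≤ (((G0n (canonK (z - u)) : ℝ) + Tn) / DG) := by
    intro z hz u hu
    rw [add_div]
    refine add_le_add ?_ le_rfl
    rw [← G0H_canonK k hg, le_div_iff₀ hDGR]
    exact hG0 _ (hCL _ (hzu z hz u hu))
  have hG1' : ∀ z ∈ boxList t (2 * m), ∀ u ∈ boxList t (4 * m),
      G1H k m g N (z - u) + (Tn : ℝ) / DG ≤ (((G1n (canonK (z - u)) : ℝ) + Tn) / DG) := by
    intro z hz u hu
    rw [add_div]
    refine add_le_add ?_ le_rfl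
    rw [← G1H_canonK k hg, le_div_iff₀ hDGR]
    exact hG1 _ (hCL _ (hzu z hz u hu))
  have hVgen : ∀ (Gr : (Fin t → ℤ) → ℝ) (Gn Vn : (Fin t → ℤ) → ℕ),
      (∀ z ∈ boxList t (2 * m), ∀ u ∈ boxList t (4 * m),
        Gr (z - u) + (Tn : ℝ) / DG ≤ (((Gn (canonK (z - u)) : ℝ) + Tn) / DG)) →
      (∀ u ∈ boxList t (4 * m), 1 + ((boxList t (2 * m)).map fun z => (Gn (canonK (z - u)) + Tn) * Φn z).sum ≤ Vn u) →
      ∀ u ∈ Box t (4 * m), (1 / ((DG * DΦ : ℕ) : ℝ) + ∑ z ∈ Box t (2 * m), (Gr (z - u) + (Tn : ℝ) / DG) * φ z) ≤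
        (Vn u : ℝ) / ((DG * DΦ : ℕ) : ℝ) := by
    intro Gr Gn Vn hGr hVn u hu
    rw [Box_eq_toFinset, List.mem_toFinset] at hu
    have hsum : ∑ z ∈ Box t (2 * m), (Gr (z - u) + (Tn : ℝ) / DG) * φ z ≤
        ∑ z ∈ Box t (2 * m), ((((Gn (canonK (z - u)) : ℝ) + Tn) / DG) * ((Φn z : ℝ) / DΦ)) :=
      sum_le_sum fun z hz => by
        rw [hφin z (hYb z hz)]
        exact mul_le_mul_of_nonneg_right (hGr z (hYb z hz) u hu) (by positivity)
    have hcast : ((Vn u : ℝ)) ≥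
        ((1 + ((boxList t (2 * m)).map fun z => (Gn (canonK (z - u)) + Tn) * Φn z).sum : ℕ) : ℝ) := by
      exact_mod_cast hVn u hu
    rw [cast_boxSum m] at hcast
    have heq : ∑ z ∈ Box t (2 * m), ((((Gn (canonK (z - u)) : ℝ) + Tn) / DG) * ((Φn z : ℝ) / DΦ)) =
        (∑ z ∈ Box t (2 * m), (((Gn (canonK (z - u)) : ℝ) + Tn) * Φn z)) / ((DG * DΦ : ℕ) : ℝ) := by
      rw [Finset.sum_div]
      exact sum_congr rfl fun z _ => by push_cast; ring
    rw [heq] at hsum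
    have hpos : (0 : ℝ) < ((DG * DΦ : ℕ) : ℝ) := by positivity
    calc 1 / ((DG * DΦ : ℕ) : ℝ) + ∑ z ∈ Box t (2 * m), (Gr (z - u) + (Tn : ℝ) / DG) * φ z
        ≤ (1 + ∑ z ∈ Box t (2 * m), (((Gn (canonK (z - u)) : ℝ) + Tn) * Φn z)) / ((DG * DΦ : ℕ) : ℝ) := by
          rw [add_div]; exact add_le_add le_rfl hsum
      _ ≤ (Vn u : ℝ) / ((DG * DΦ : ℕ) : ℝ) := div_le_div_of_nonneg_right hcast hpos.le
  have hV0' : ∀ u ∈ Box t (4 * m), V0H k m g N ((Tn : ℝ) / DG) (1 / ((DG * DΦ : ℕ) : ℝ)) φ u ≤ V0f u :=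
    hVgen (G0H k m g N) G0n V0n hG0' hV0
  have hV1' : ∀ u ∈ Box t (4 * m), V1H k m g N ((Tn : ℝ) / DG) (1 / ((DG * DΦ : ℕ) : ℝ)) φ u ≤ V1f u :=
    hVgen (G1H k m g N) G1n V1n hG1' hV1
  have hx : (1 / ((P : ℝ) / 10000)) = ((10000 : ℕ) : ℝ) / P := by push_cast; field_simp
  have hcert' : ∀ y ∈ Box t (2 * m), certLHSV pc w k (1 / ((P : ℝ) / 10000)) V0f V1f y ≤ φ y := by
    intro y hy
    replace hy := hYb y hy
    have h := (Int.cast_mono (R := ℝ)) (hcert y hy)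
    have hSt' : certLHSVz pe St W k 10000 P E V0n V1n y = certLHSVz pe (SV pc k) W k 10000 P E V0n V1n y := by
      unfold certLHSVz; simp only [hSt y hy]
    rw [hSt'] at h
    push_cast at h
    rw [certLHSVz_cast pc hpe W (by omega) 10000 hP0 hE V0n V1n y hDW (by positivity : 0 < DG * DΦ)] at h
    rw [hx, hφin y hy]
    rw [hw, hV0f, hV1f]
    push_cast at h ⊢
    have hMpos : (0 : ℝ) < (k : ℝ) * (P : ℝ) ^ E * (DW : ℝ) ^ 2 * ((DG : ℝ) * DΦ) * DΦ := by positivity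
    refine le_of_mul_le_mul_right ?_ hMpos
    calc _ = certLHSV pc (fun σ => (W σ : ℝ) / DW) k ((10000 : ℝ) / P) (fun u => (V0n u : ℝ) / ((DG : ℝ) * DΦ))
          (fun u => (V1n u : ℝ) / ((DG : ℝ) * DΦ)) y * ((k : ℝ) * (P : ℝ) ^ E * (DW : ℝ) ^ 2 * ((DG : ℝ) * DΦ)) * DΦ := by
          ring
      _ ≤ (Φn y : ℝ) * ((P : ℝ) ^ E * k * (DW : ℝ) ^ 2 * ((DG : ℝ) * DΦ)) := h
      _ = _ := by field_simp
  exact siteCriticalProb_le_of_certV hk hg hcube hvc hmarg' hw0 hp0 hp1 hT (by positivity) φ hφ0 hV0' hV1' hcert'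

/-- **Orbit reduction of the integer site certificate** (`[-R₁,R₁]^2` → representatives), any shared-vertex count
`St` that agrees with `BSMX.SV`. -/
theorem certZV_of_reps (R₁ : ℕ) (pc : Fin np → List (Fin 2 × Bool)) {pe : Fin np → (Fin 2 → ℤ)}
    (hpe : ∀ σ, pe σ = pend (pc σ)) {k : ℕ} (St : (Fin 2 → ℤ) → Fin np → Fin np → ℕ)
    (hSt : ∀ y σ σ', St y σ σ' = SV pc k y σ σ') (W : Fin np → ℕ) (hk : 1 ≤ k) {B E : ℕ}
    (hB : 0 < B) (hE : ∀ σ, (pc σ).length + 1 ≤ E) (π₁ π₂ : Fin np ≃ Fin np)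
    (hπ₁ : ∀ σ, pc (π₁ σ) = (pc σ).map (pq (Equiv.swap 0 1)))
    (hπ₂ : ∀ σ, pc (π₂ σ) = (pc σ).map (flipAx 0))
    (hW₁ : ∀ σ, W (π₁ σ) = W σ) (hW₂ : ∀ σ, W (π₂ σ) = W σ)
    (V0n V1n Φn : (Fin 2 → ℤ) → ℕ) (hV0 : ∀ g u, V0n (gen2 g u) = V0n u) (hV1 : ∀ g u, V1n (gen2 g u) = V1n u)
    (hΦ : ∀ g u, Φn (gen2 g u) = Φn u) (DΦ M : ℤ) (R : List (Fin 2 → ℤ)) (G : List (List (Fin 3)))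
    (hclos : ∀ y ∈ boxList 2 R₁, ∃ w ∈ G, applyW2 w y ∈ R)
    (hR : ∀ y ∈ R, certLHSVz pe St W k 10000 B E V0n V1n y * DΦ ≤ (Φn y : ℤ) * M) :
    ∀ y ∈ boxList 2 R₁, certLHSVz pe St W k 10000 B E V0n V1n y * DΦ ≤ (Φn y : ℤ) * M := by
  have hV0a : ∀ u, V0n (-u) = V0n u := fun u => by rw [← (gen2_apply u).1]; exact hV0 0 u
  have hV0b : ∀ u, V0n (pv (Equiv.swap 0 1) u) = V0n u := fun u => by rw [← (gen2_apply u).2.1]; exact hV0 1 u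
  have hV1a : ∀ u, V1n (-u) = V1n u := fun u => by rw [← (gen2_apply u).1]; exact hV1 0 u
  have hV1b : ∀ u, V1n (pv (Equiv.swap 0 1) u) = V1n u := fun u => by rw [← (gen2_apply u).2.1]; exact hV1 1 u
  have hV0d : ∀ u, V0n (negC 0 u) = V0n u := fun u => by rw [← (gen2_apply u).2.2]; exact hV0 2 u
  have hV1d : ∀ u, V1n (negC 0 u) = V1n u := fun u => by rw [← (gen2_apply u).2.2]; exact hV1 2 u
  have hS2 : St = SV pc k := funext fun y => funext fun σ => funext fun σ' => hSt y σ σ'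
  rw [hS2] at hR ⊢
  set f : (Fin 2 → ℤ) → ℤ := fun y => certLHSVz pe (SV pc k) W k 10000 B E V0n V1n y with hf
  have hcast : ∀ z, ((f z : ℤ) : ℝ) = certLHSV pc (fun σ => (W σ : ℝ) / (1 : ℕ)) k ((10000 : ℕ) / (B : ℝ))
      (fun u => (V0n u : ℝ) / (1 : ℕ)) (fun u => (V1n u : ℝ) / (1 : ℕ)) z *
        ((k : ℝ) * (B : ℝ) ^ E * ((1 : ℕ) : ℝ) ^ 2 * (1 : ℕ)) := fun z =>
    certLHSVz_cast pc hpe W hk 10000 hB hE V0n V1n z Nat.one_pos Nat.one_pos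
  have h0 : ∀ z, f (-z) = f z := fun z => by
    apply Int.cast_injective (α := ℝ)
    rw [hcast, hcast, certLHSV_neg pc _ k _ (fun u => by simp only [hV0a]) (fun u => by simp only [hV1a])]
  have h1 : ∀ z, f (pv (Equiv.swap 0 1) z) = f z := fun z => by
    apply Int.cast_injective (α := ℝ)
    rw [hcast, hcast, certLHSV_perm pc _ k _ (Equiv.swap 0 1) π₁ hπ₁ (fun σ => by simp only [hW₁])
      (fun u => by simp only [hV0b]) (fun u => by simp only [hV1b])]
  have h3 : ∀ z, f (negC 0 z) = f z := fun z => by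
    apply Int.cast_injective (α := ℝ)
    rw [hcast, hcast, certLHSV_flip pc _ k _ 0 π₂ hπ₂ (fun σ => by simp only [hW₂])
      (fun u => by simp only [hV0d]) (fun u => by simp only [hV1d])]
  have hgen : ∀ g z, f (gen2 g z) = f z := fun g z => by
    rcases gen2_apply z with ⟨e0, e1, e2⟩
    fin_cases g
    · exact (congr_arg f e0).trans (h0 z)
    · exact (congr_arg f e1).trans (h1 z)
    · exact (congr_arg f e2).trans (h3 z)
  intro y hy
  obtain ⟨w, _, hwR⟩ := hclos y hy
  have hfy : f (applyW2 w y) = f y := applyW2_invariant' f hgen w y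
  have hΦy : Φn (applyW2 w y) = Φn y := applyW2_invariant' Φn hΦ w y
  have := hR _ hwR
  rw [← hΦy]
  rw [hf] at hfy
  simp only at hfy
  rw [← hfy]
  exact this

end Summit.CriticalPhenomena.PercolationContinuityZ3.Theorems.Pcint.BSMR

end
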